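import Summits.AtomisticToContinuum.HydrodynamicLimit.Theorems.RelayRaceLocalityConeLocalisationStubLogCurvatureC
import HarnessLib

/-!
# RelayRaceLocality · ConeLocalisation — line `einstein-elevator`, stub `stub_logCurvature`

Support file for the crux item `stmt-AtomisticToContinuum-12504` (`ConeLocalisation`, route RelayRaceLocality of
`AtomisticToContinuum/HydrodynamicLimit`), proving the registered stub

  `stub_logCurvature : DynamicLogSlopeBound → DynamicLogCurvatureBound`

of the skeleton of the line `einstein-elevator` (Props in
`Theorems/RelayRaceLocalityConeLocalisationElevatorDefs.lean`): order 2 of the floor-free dynamic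
log-Lipschitz rigidity of the guard class of the short-time guarded hydrodynamic limit — if the
level-`M` guards of `S` are alive on `[0, t] × 𝕋³` then `|∂ᵢ∂ⱼ log ρ| ≤ C Mᵃ / t` there (fourth of
four files; parts A, B, C carry the ODE lemma, the EOS band, the Eulerian identities one derivative up
and the Lagrangian step).

## Proof (Lagrangian both-ends argument, one derivative up)

Along a characteristic `γ` of `u` the velocity GRADIENT is guarded at both ends (`|∂ᵢuⱼ| ≤ M`), and
`d/ds ∂ᵢuⱼ = -(∂ᵢGⱼ + Σₖ ∂ᵢuₖ ∂ₖuⱼ)` with `G = ∇p/ρ = θ κ(ρσ³) ∇log ρ + Zf(ρσ³) ∇θ`; the matrix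
`g = ∂G ∘ γ` satisfies `‖g'‖ ≤ A ‖g‖ + B₁ q + B₂` with `A, Bᵢ` polynomial in `M` and `q = C' M^{a'}/t`
the order-1 bound (the HYPOTHESIS `DynamicLogSlopeBound`) — the `1/ρ`'s cancel in the material form of
`∂ᵢ∂ⱼ log ρ`. The both-ends ODE lemma with remainder gives `‖g‖ ≤ C″ Mᵇ / t`, and `∂ᵢ∂ⱼ log ρ` is read
off `∂ᵢGⱼ = θ κ ∂ᵢ∂ⱼ log ρ + …` (`θ κ ≥ 1/(2KM)`). No density floor enters. Constants: `η₁ = min` of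
the EOS band and the hypothesis' band, `C = 2000 (C' + 1) K⁹`, `a = a' + 9`.
-/

noncomputable section

namespace Summit.AtomisticToContinuum.HydrodynamicLimit.Theorems.ConeLocalisation.Elevator

open scoped Topology ContDiff NNReal
open Filter Set MeasureTheory
open Literature.MathematicalPhysics.KineticTheory Literature.Analysis.FluidPDE
  Literature.Analysis.FunctionSpaces
open Literature.Analysis.FluidPDE.CompressibleEuler (abs_mul_le_of_le)
open LogCurvature

/-! ### Step 10: the stub -/

/-- **STUB `stub_logCurvature` of the line `einstein-elevator`** (registered on
stmt-AtomisticToContinuum-12504): the dynamic log-curvature bound — given the dynamic log-slope bound,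
the level-`M` guards of `S` alive on `[0, t] × 𝕋³` force `|∂ᵢ∂ⱼ log ρ| ≤ C Mᵃ / t` there, with NO
density floor (Lagrangian both-ends argument for the velocity gradient). [folklore] -/
theorem stub_logCurvature : DynamicLogSlopeBound → DynamicLogCurvatureBound := by
  rintro ⟨η₁', hη₁', C', hC', a', hslope⟩
  obtain ⟨η₀, ηe, K, Zf, hηe, hηe1, hηe0, hK, hZ, hEq, hbande⟩ := eos_band3
  have hη₁ : 0 < min ηe η₁' := lt_min hηe hη₁'
  have hη₁1 : min ηe η₁' ≤ 1 := (min_le_left _ _).trans hηe1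
  have hη₁₀ : 2 * min ηe η₁' ≤ η₀ := by linarith [min_le_left ηe η₁']
  have hband : ∀ η ∈ Icc 0 (min ηe η₁'), |Zf η| ≤ K ∧ |deriv Zf η| ≤ K ∧
      |deriv (deriv Zf) η| ≤ K ∧ |deriv (deriv (deriv Zf)) η| ≤ K ∧ 1 / 2 ≤ Zf η ∧
      1 / 2 ≤ Zf η + η * deriv Zf η := fun η hη =>
    hbande η ⟨hη.1, hη.2.trans (min_le_left _ _)⟩
  have hK0 : 0 < K := by linarith
  refine ⟨min ηe η₁', hη₁, 2000 * (C' + 1) * K ^ 9, by positivity, a' + 9, ?_⟩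
  intro M hM σ T₀ ρ θ u hσ hσ1 hE₀ t ht htT₀ hsmall hG s hs x i j
  have hM0 : 0 < M := by linarith
  -- the level `N = K M`
  obtain ⟨N, hNKM⟩ : ∃ N : ℝ, N = K * M := ⟨_, rfl⟩
  have hN : 1 ≤ N := hNKM ▸ one_le_mul_of_one_le_of_one_le hK hM
  have hMN : M ≤ N := hNKM ▸ le_mul_of_one_le_left hM0.le hK
  have hKN : K ≤ N := hNKM ▸ le_mul_of_one_le_right hK0.le hM
  have hN0 : 0 < N := by linarith
  -- smallness of `t`
  have hK9 : 1 ≤ K ^ 9 := one_le_pow₀ hK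
  have hMa : 1 ≤ M ^ (a' + 9) := one_le_pow₀ hM
  have hMa' : M ^ a' ≤ M ^ (a' + 9) := pow_le_pow_right₀ hM (by omega)
  have hle : ∀ X, X ≤ 2000 * (C' + 1) * K ^ 9 * M ^ (a' + 9) → t * X ≤ 1 := fun X hX =>
    (mul_le_mul_of_nonneg_left hX ht.le).trans hsmall
  have hX0 : 0 ≤ K ^ 9 * M ^ (a' + 9) := by positivity
  have h2000 : (1 : ℝ) ≤ 2000 * (C' + 1) := by linarith
  have ht1 : t ≤ 1 := by
    have h := hle 1 (one_le_mul_of_one_le_of_one_le (one_le_mul_of_one_le_of_one_le h2000 hK9) hMa)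
    simpa using h
  have hsmallq : t * (C' * M ^ a') ≤ 1 := by
    refine hle _ ?_
    have h1 : C' * M ^ a' ≤ C' * M ^ (a' + 9) := mul_le_mul_of_nonneg_left hMa' hC'.le
    have h2 : C' * M ^ (a' + 9) ≤ C' * (K ^ 9 * M ^ (a' + 9)) := by
      rw [← mul_assoc]
      exact mul_le_mul_of_nonneg_right (le_mul_of_one_le_right hC'.le hK9) (by positivity)
    have h3 : C' * (K ^ 9 * M ^ (a' + 9)) ≤ 2000 * (C' + 1) * (K ^ 9 * M ^ (a' + 9)) :=
      mul_le_mul_of_nonneg_right (by linarith) hX0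
    have h4 : 2000 * (C' + 1) * (K ^ 9 * M ^ (a' + 9)) = 2000 * (C' + 1) * K ^ 9 * M ^ (a' + 9) := by
      ring
    linarith only [h1, h2, h3, h4]
  have hAt : 50 * N ^ 5 * (t - 0) ≤ 1 / 4 := by
    rw [sub_zero]
    have h5 : N ^ 5 ≤ K ^ 9 * M ^ (a' + 9) := by
      rw [hNKM, mul_pow]
      exact mul_le_mul (pow_le_pow_right₀ hK (by norm_num)) (pow_le_pow_right₀ hM (by omega))
        (by positivity) (by positivity)
    have h6 : 200 * (K ^ 9 * M ^ (a' + 9)) ≤ 2000 * (C' + 1) * (K ^ 9 * M ^ (a' + 9)) :=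
      mul_le_mul_of_nonneg_right (by linarith) hX0
    have h7 : 2000 * (C' + 1) * (K ^ 9 * M ^ (a' + 9)) = 2000 * (C' + 1) * K ^ 9 * M ^ (a' + 9) := by
      ring
    have h := hle (200 * N ^ 5) (by linarith only [h5, h6, h7])
    linarith only [h]
  -- the order-1 bound (the hypothesis) on the band `η₁'`
  have hGη' : ∀ s ∈ Icc 0 t, ∀ x, GuardAt η₁' M σ ρ θ u s x := fun s hs x =>
    guardAt_mono (hG s hs x) (min_le_right _ _)
  have hQ0 := hslope M hM σ T₀ ρ θ u hσ hσ1 hE₀ t ht htT₀ hsmallq hGη'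
  obtain ⟨q, hqdef⟩ : ∃ q : ℝ, q = C' * M ^ a' / t := ⟨_, rfl⟩
  have hq0 : 0 ≤ q := by rw [hqdef]; positivity
  have hqt : q * t = C' * M ^ a' := by rw [hqdef]; exact div_mul_cancel₀ _ ht.ne'
  have hQ : ∀ s ∈ Icc 0 t, ∀ x k, |Torus.partialDeriv k (fun z => Real.log (ρ s z)) x| ≤ q :=
    fun s hs x k => hqdef ▸ hQ0 s hs x k
  -- restrict to a slab `[0, T)` on which the packing stays `< η₁`
  obtain ⟨T, htT, hTT₀, hpack⟩ := RestartPrincipleNegative.exists_packing_extension hE₀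
    ⟨ht.le, htT₀⟩ (fun s hs x => (hG s hs x).1) hσ
  have hE : IsHardSphereEulerSolution σ T ρ u θ := hE₀.restrict hTT₀
  have hsub : Icc 0 t ⊆ Ico 0 T := Icc_subset_Ico_right htT
  -- Lipschitz bound for the characteristics on `[0, t]`
  have hLip : ∀ τ ∈ Icc 0 t, LipschitzWith ⟨3 * M, by positivity⟩ (Torus.lift (u τ)) := by
    intro τ hτ
    have hus : Torus.IsSmooth (u τ) := hE.smooth_velocity.isSmooth_slice (hsub hτ)
    have hu1 : Torus.IsContDiff 1 (u τ) := hus.isContDiff (by simp)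
    refine Torus.lipschitzWith_lift_of_norm_fderiv_le hu1 fun z => ?_
    show ‖Torus.fderiv (u τ) z‖ ≤ 3 * M
    refine ContinuousLinearMap.opNorm_le_bound _ (by positivity) fun w => ?_
    rw [Torus.fderiv_apply_eq_sum_partialDeriv hu1]
    have hb : ∀ i, ‖Torus.partialDeriv i (u τ) z‖ ≤ M := fun i =>
      ((hG τ hτ z).2.2.2.2.2 i 0 0).2.1
    calc ‖∑ i, w i • Torus.partialDeriv i (u τ) z‖
        ≤ ∑ i, ‖w i • Torus.partialDeriv i (u τ) z‖ := norm_sum_le _ _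
      _ ≤ ∑ _i : Fin 3, ‖w‖ * M := Finset.sum_le_sum fun i _ => by
          rw [norm_smul]
          exact mul_le_mul (PiLp.norm_apply_le w i) (hb i) (norm_nonneg _) (norm_nonneg _)
      _ = 3 * M * ‖w‖ := by
          simp only [Finset.sum_const, Finset.card_univ, Fintype.card_fin, nsmul_eq_mul]
          push_cast
          ring
  -- the characteristic through `(s, x)`
  obtain ⟨γ, hγs, hγ⟩ :=
    Torus.exists_characteristic (hE.smooth_velocity.mono hsub) hLip hs (Torus.repr x)
  have hx : Torus.proj (γ s) = x := by rw [hγs, Torus.proj_repr]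
  -- `∂G` and `∂u ∂u` along `γ`
  obtain ⟨g, hg⟩ : ∃ g : ℝ → Fin 3 → Fin 3 → ℝ, ∀ s' i j, g s' i j =
      (Torus.partialDeriv i (θ s') (Torus.proj (γ s')) *
            (Zf (ρ s' (Torus.proj (γ s')) * σ ^ 3) + ρ s' (Torus.proj (γ s')) * σ ^ 3 *
              deriv Zf (ρ s' (Torus.proj (γ s')) * σ ^ 3)) +
          θ s' (Torus.proj (γ s')) * ((2 * deriv Zf (ρ s' (Torus.proj (γ s')) * σ ^ 3) +
            ρ s' (Torus.proj (γ s')) * σ ^ 3 *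
              deriv (deriv Zf) (ρ s' (Torus.proj (γ s')) * σ ^ 3)) *
            (Torus.partialDeriv i (ρ s') (Torus.proj (γ s')) * σ ^ 3))) *
          Torus.partialDeriv j (fun z => Real.log (ρ s' z)) (Torus.proj (γ s')) +
        θ s' (Torus.proj (γ s')) * (Zf (ρ s' (Torus.proj (γ s')) * σ ^ 3) +
            ρ s' (Torus.proj (γ s')) * σ ^ 3 * deriv Zf (ρ s' (Torus.proj (γ s')) * σ ^ 3)) *
          Torus.partialDeriv i (Torus.partialDeriv j (fun z => Real.log (ρ s' z)))
            (Torus.proj (γ s')) +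
        (deriv Zf (ρ s' (Torus.proj (γ s')) * σ ^ 3) *
              (Torus.partialDeriv i (ρ s') (Torus.proj (γ s')) * σ ^ 3) *
            Torus.partialDeriv j (θ s') (Torus.proj (γ s')) +
          Zf (ρ s' (Torus.proj (γ s')) * σ ^ 3) *
            Torus.partialDeriv i (Torus.partialDeriv j (θ s')) (Torus.proj (γ s'))) :=
    ⟨_, fun _ _ _ => rfl⟩
  obtain ⟨r, hr⟩ : ∃ r : ℝ → Fin 3 → Fin 3 → ℝ, ∀ s' i j, r s' i j =
      ∑ k, Torus.partialDeriv i (fun z => u s' z k) (Torus.proj (γ s')) *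
        Torus.partialDeriv k (fun z => u s' z j) (Torus.proj (γ s')) :=
    ⟨_, fun _ _ _ => rfl⟩
  have du := fun τ (hτ : τ ∈ Icc 0 t) =>
    lagrangian_du hE hZ hEq hσ hη₁₀ hMN hpack ht htT hG hτ (hγ τ hτ) hg hr
  -- the log-curvature along `γ` in terms of `‖g‖`
  have hσ3 : |σ ^ 3| ≤ 1 := by
    rw [abs_of_pos (pow_pos hσ 3)]
    exact pow_le_one₀ hσ.le hσ1
  have hH : ∀ τ ∈ Icc 0 t, ∀ k l,
      |Torus.partialDeriv k (Torus.partialDeriv l (fun z => Real.log (ρ τ z))) (Torus.proj (γ τ))| ≤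
        2 * N * (‖g τ‖ + 5 * N ^ 3 * q + 2 * N ^ 3) := by
    intro τ hτ k l
    have hτ' : τ ∈ Ico 0 T := hsub hτ
    have hGτ := hG τ hτ (Torus.proj (γ τ))
    have hρpos := hE.density_pos τ hτ' (Torus.proj (γ τ))
    have hθpos := hE.temperature_pos τ hτ' (Torus.proj (γ τ))
    have hepos : 0 < ρ τ (Torus.proj (γ τ)) * σ ^ 3 := mul_pos hρpos (pow_pos hσ 3)
    have hus : Torus.IsSmooth (u τ) := hE.smooth_velocity.isSmooth_slice hτ'
    obtain ⟨hpk, hθN, hθM, -, hdρ, hdθ, hddθ, -, -⟩ := LogSlope.guard_bounds hGτ hMN hus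
    have hθa : |θ τ (Torus.proj (γ τ))| ≤ N := by rw [abs_of_pos hθpos]; exact hθN
    have hθlow : N⁻¹ ≤ θ τ (Torus.proj (γ τ)) := (inv_anti₀ hM0 hMN).trans hθM
    obtain ⟨-, hZa, hZ'a, -, -, lκ, hκa, hκ'a, -, -, -⟩ :=
      eos_point hZ hη₁1 hη₁₀ hband hKN hepos hpk
    have hdη := abs_mul_le_of_le (hdρ k) hσ3
    have hc : |Torus.partialDeriv k (θ τ) (Torus.proj (γ τ)) *
          (Zf (ρ τ (Torus.proj (γ τ)) * σ ^ 3) + ρ τ (Torus.proj (γ τ)) * σ ^ 3 *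
            deriv Zf (ρ τ (Torus.proj (γ τ)) * σ ^ 3)) +
        θ τ (Torus.proj (γ τ)) * ((2 * deriv Zf (ρ τ (Torus.proj (γ τ)) * σ ^ 3) +
          ρ τ (Torus.proj (γ τ)) * σ ^ 3 *
            deriv (deriv Zf) (ρ τ (Torus.proj (γ τ)) * σ ^ 3)) *
          (Torus.partialDeriv k (ρ τ) (Torus.proj (γ τ)) * σ ^ 3))| ≤ 5 * N ^ 3 := by
      have t1 := abs_mul_le_of_le (hdθ k) hκa
      have t2 := abs_mul_le_of_le hθa (abs_mul_le_of_le hκ'a hdη)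
      have p23 : N ^ 2 ≤ N ^ 3 := pow_le_pow_right₀ hN (by norm_num)
      refine (abs_add_le _ _).trans ?_
      linarith only [t1, t2, p23]
    have he : |deriv Zf (ρ τ (Torus.proj (γ τ)) * σ ^ 3) *
          (Torus.partialDeriv k (ρ τ) (Torus.proj (γ τ)) * σ ^ 3) *
          Torus.partialDeriv l (θ τ) (Torus.proj (γ τ)) +
        Zf (ρ τ (Torus.proj (γ τ)) * σ ^ 3) *
          Torus.partialDeriv k (Torus.partialDeriv l (θ τ)) (Torus.proj (γ τ))| ≤ 2 * N ^ 3 := by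
      have t1 := abs_mul_le_of_le (abs_mul_le_of_le hZ'a hdη) (hdθ l)
      have t2 := abs_mul_le_of_le hZa (hddθ k l)
      have p23 : N ^ 2 ≤ N ^ 3 := pow_le_pow_right₀ hN (by norm_num)
      refine (abs_add_le _ _).trans ?_
      linarith only [t1, t2, p23]
    have h := abs_curv_le hN hθlow lκ hc (hQ τ hτ _ l) he (hg τ k l).symm
    refine h.trans ?_
    have h1 : |g τ k l| ≤ ‖g τ‖ := by
      have h2 := norm_le_pi_norm (g τ) k
      have h3 := norm_le_pi_norm (g τ k) l
      rw [Real.norm_eq_abs] at h3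
      exact h3.trans h2
    gcongr
  -- the derivative of `g` along `γ`, with the linear bound
  have hgODE : ∀ τ ∈ Icc 0 t, ∃ v, HasDerivWithinAt g v (Icc 0 t) τ ∧
      ‖v‖ ≤ 50 * N ^ 5 * ‖g τ‖ + (205 * N ^ 8 + 373 * N ^ 8 * q) := by
    intro τ hτ
    have hh0 : 0 ≤ 2 * N * (‖g τ‖ + 5 * N ^ 3 * q + 2 * N ^ 3) := by positivity
    obtain ⟨v, hv, hb⟩ := lagrangian_dg hE hZ hEq hσ hσ1 hη₁1 hη₁₀ hband hN hMN hKN hpack ht htT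
      hG hq0 hQ hτ (hγ τ hτ) hh0 (hH τ hτ) hg
    refine ⟨v, hv, hb.trans ?_⟩
    have p68 : N ^ 6 ≤ N ^ 8 := pow_le_pow_right₀ hN (by norm_num)
    have p58 : N ^ 5 * q ≤ N ^ 8 * q :=
      mul_le_mul_of_nonneg_right (pow_le_pow_right₀ hN (by norm_num)) hq0
    linarith only [p68, p58]
  -- the both-ends lemma for `φ = ∂u ∘ γ`, `g = ∂G ∘ γ`, `r = (∂u ∂u) ∘ γ`
  have hφ : ∀ τ ∈ Icc 0 t, HasDerivWithinAt
      (fun τ => (fun i j => Torus.partialDeriv i (fun z => u τ z j) (Torus.proj (γ τ)) :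
        Fin 3 → Fin 3 → ℝ)) (-(g τ + r τ)) (Icc 0 t) τ := fun τ hτ =>
    hasDerivWithinAt_pi.2 fun i => hasDerivWithinAt_pi.2 fun j => by
      simp only [Pi.neg_apply, Pi.add_apply]
      exact (du τ hτ i j).1
  have hr3 : ∀ τ ∈ Icc 0 t, ‖r τ‖ ≤ 3 * N ^ 2 := fun τ hτ =>
    (pi_norm_le_iff_of_nonneg (by positivity)).2 fun i =>
      (pi_norm_le_iff_of_nonneg (by positivity)).2 fun j => by
        rw [Real.norm_eq_abs]
        exact (du τ hτ i j).2.1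
  have hb : ∀ τ ∈ Icc 0 t, ‖(fun i j => Torus.partialDeriv i (fun z => u τ z j) (Torus.proj (γ τ)) :
      Fin 3 → Fin 3 → ℝ)‖ ≤ N := fun τ hτ =>
    (pi_norm_le_iff_of_nonneg hN0.le).2 fun i => (pi_norm_le_iff_of_nonneg hN0.le).2 fun j => by
      rw [Real.norm_eq_abs]
      exact (du τ hτ i j).2.2
  have hD : ‖(fun i j => Torus.partialDeriv i (fun z => u t z j) (Torus.proj (γ t)) :
        Fin 3 → Fin 3 → ℝ) -
      (fun i j => Torus.partialDeriv i (fun z => u 0 z j) (Torus.proj (γ 0)) :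
        Fin 3 → Fin 3 → ℝ)‖ ≤ 2 * N :=
    (norm_sub_le _ _).trans (by linarith only [hb t ⟨ht.le, le_rfl⟩, hb 0 ⟨le_rfl, ht.le⟩])
  have hODE := norm_le_of_both_ends_rem
    (φ := fun τ => (fun i j => Torus.partialDeriv i (fun z => u τ z j) (Torus.proj (γ τ)) :
      Fin 3 → Fin 3 → ℝ))
    ht hφ hr3 hgODE (by positivity) (by positivity) hAt hD hs
  rw [sub_zero] at hODE
  -- the log-curvature at `(s, x)`
  have hHs := hH s hs i j
  rw [hx] at hHs
  -- final arithmetic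
  have ht0 : t ≠ 0 := ht.ne'
  have hP0 : 0 ≤ C' * M ^ a' := by positivity
  have h1 : ‖g s‖ * t ≤ 3 * N + 9 / 2 * N ^ 2 * t + 410 * N ^ 8 * (t * t) +
      746 * N ^ 8 * (q * t) * t := by
    calc ‖g s‖ * t ≤ (3 / 2 * (2 * N + 3 * N ^ 2 * t) / t +
        2 * (205 * N ^ 8 + 373 * N ^ 8 * q) * t) * t := mul_le_mul_of_nonneg_right hODE ht.le
      _ = 3 * N + 9 / 2 * N ^ 2 * t + 410 * N ^ 8 * (t * t) + 746 * N ^ 8 * (q * t) * t := by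
          field_simp
          ring
  rw [hqt] at h1
  have h2 : ‖g s‖ * t ≤ 3 * N + 9 / 2 * N ^ 2 + 410 * N ^ 8 + 746 * N ^ 8 * (C' * M ^ a') := by
    have e1 : N ^ 2 * t ≤ N ^ 2 := mul_le_of_le_one_right (by positivity) ht1
    have e2 : N ^ 8 * (t * t) ≤ N ^ 8 :=
      mul_le_of_le_one_right (by positivity) (mul_le_one₀ ht1 ht.le ht1)
    have e3 : N ^ 8 * (C' * M ^ a') * t ≤ N ^ 8 * (C' * M ^ a') :=
      mul_le_of_le_one_right (by positivity) ht1
    linarith only [h1, e1, e2, e3]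
  have h3 : |Torus.partialDeriv i (Torus.partialDeriv j fun y => Real.log (ρ s y)) x| * t ≤
      839 * N ^ 9 + 1502 * N ^ 9 * (C' * M ^ a') := by
    have e0 := mul_le_mul_of_nonneg_right hHs ht.le
    have e1 : 2 * N * (‖g s‖ + 5 * N ^ 3 * q + 2 * N ^ 3) * t =
        2 * N * (‖g s‖ * t) + 10 * N ^ 4 * (q * t) + 4 * N ^ 4 * t := by ring
    rw [e1, hqt] at e0
    have p29 : N ^ 2 ≤ N ^ 9 := pow_le_pow_right₀ hN (by norm_num)
    have p39 : N ^ 3 ≤ N ^ 9 := pow_le_pow_right₀ hN (by norm_num)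
    have p49 : N ^ 4 ≤ N ^ 9 := pow_le_pow_right₀ hN (by norm_num)
    have p49' : N ^ 4 * (C' * M ^ a') ≤ N ^ 9 * (C' * M ^ a') :=
      mul_le_mul_of_nonneg_right p49 hP0
    have e4 : N ^ 4 * t ≤ N ^ 4 := mul_le_of_le_one_right (by positivity) ht1
    have e5 := mul_le_mul_of_nonneg_left h2 (by positivity : (0 : ℝ) ≤ 2 * N)
    linarith only [e0, e4, e5, p29, p39, p49, p49']
  have h4 : 839 * N ^ 9 + 1502 * N ^ 9 * (C' * M ^ a') ≤
      2000 * (C' + 1) * K ^ 9 * M ^ (a' + 9) := by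
    have e1 : N ^ 9 = K ^ 9 * M ^ 9 := by rw [hNKM, mul_pow]
    have e2 : M ^ 9 * M ^ a' = M ^ (a' + 9) := by rw [← pow_add, add_comm]
    have e3 : M ^ 9 ≤ M ^ (a' + 9) := pow_le_pow_right₀ hM (by omega)
    have e4 : N ^ 9 * (C' * M ^ a') = C' * (K ^ 9 * M ^ (a' + 9)) := by
      rw [e1, ← e2]; ring
    have e5 : K ^ 9 * M ^ 9 ≤ K ^ 9 * M ^ (a' + 9) := mul_le_mul_of_nonneg_left e3 (by positivity)
    have e6 : 0 ≤ C' * (K ^ 9 * M ^ (a' + 9)) := by positivity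
    have e7 : 2000 * (C' + 1) * K ^ 9 * M ^ (a' + 9) =
        2000 * (C' * (K ^ 9 * M ^ (a' + 9))) + 2000 * (K ^ 9 * M ^ (a' + 9)) := by ring
    have e8 : 1502 * N ^ 9 * (C' * M ^ a') = 1502 * (C' * (K ^ 9 * M ^ (a' + 9))) := by
      rw [mul_assoc, e4]
    rw [e8, e7, e1]
    linarith only [e5, e6, hX0]
  rw [le_div_iff₀ ht]
  exact h3.trans h4

end Summit.AtomisticToContinuum.HydrodynamicLimit.Theorems.ConeLocalisation.Elevator

end
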